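import Literature.AlgebraicGeometry.Morphisms.Devissage
import Literature.AlgebraicGeometry.Morphisms.ExtUnitFiniteClass
import HarnessLib

/-!
# Dévissage of coherent modules for an arbitrary exact class (Görtz–Wedhorn I, Lemma 12.63; EGA III
# 3.1.2), and the reduction of the finiteness theorem to its integral heart

`Morphisms/Devissage.devissage` runs the Noetherian induction of Görtz–Wedhorn I, Lemma 12.63 ("Let
`𝒦` be a subset of the set of isomorphism classes of coherent `𝒪_X`-modules satisfying (a) … if two of
`𝓕', 𝓕, 𝓕''` are in `𝒦`, then the third is … Then every coherent `𝒪_X`-module is in `𝒦`") for the ONE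
class `InK` of `Morphisms/DevissageClass` (finite Čech `H⁰`, `H¹`). This file re-runs the same
induction — verbatim — for an ARBITRARY class `K` of modules on a quasi-compact locally Noetherian
scheme which

* contains every coherent module all of whose sections over affine opens vanish (`hK₀`), and
* is closed under extensions of coherent modules: `M', M'' ∈ K ⇒ M ∈ K` for `0 → M' → M → M'' → 0`
  short exact (`hK₂`),

GIVEN the integral heart (step (iii) of the printed proof: for every proper radical ideal sheaf `𝒥`
with irreducible support, granted the claim above `𝒥`, every coherent module killed by `𝒥` lies in
`K`): `devissage_of_exactClass`. Instantiated with the exact class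
`𝒦_Ext = {M | ∀ n, Extⁿ_{𝒪_X}(𝒪_X, M) finite over k}` of `Morphisms/ExtUnitFiniteClass` it yields

* `GortzWedhorn2023_cohomology_proper_coherent_finite_of_heart` — **the named fact
  `Morphisms/ProperCoherentCohomologyFinite` (Görtz–Wedhorn II Cor. 23.18 over a field, all coherent
  `𝓕`, all degrees, on its derived carrier) follows from its integral heart**: for every field `k`,
  every proper `X → Spec k` and every radical ideal sheaf `𝒥 ≠ ⊤` with irreducible support
  `Z = V(𝒥)` (an integral closed subscheme), granted finiteness for the coherent modules killed by the
  ideal sheaves strictly above `𝒥`, every coherent `𝒪_X`-module killed by `𝒥` (= every coherent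
  `𝒪_Z`-module, pushed forward) has finite `Extⁿ_{𝒪_X}(𝒪_X, –)` for all `n`.

The heart is Görtz–Wedhorn I, Lemma 12.63 (iii) together with II, Thm. 23.17 (3) (Chow cover /
rank-one sheaves); it is NOT proved here (for the degree-`≤ 1` class `InK` it is
`Morphisms/DevissageHeart.heart_holds`). Everything in this file is proved; no named facts.

## References

* U. Görtz, T. Wedhorn, *Algebraic Geometry I: Schemes*, 2nd ed. (2020): Lemma 12.63 and its proof,
  pp. 436–437. [GortzWedhorn2020]
* U. Görtz, T. Wedhorn, *Algebraic Geometry II* (2023): Thm. 23.17 (proof), Cor. 23.18, pp. 424–425.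
  [GortzWedhorn2023]
* A. Grothendieck, EGA III (Publ. Math. IHÉS 11, 1961), Thm. 3.1.2, Cor. 3.1.3, Thm. 3.2.1. [folklore]
-/

noncomputable section

open CategoryTheory AlgebraicGeometry Limits TopologicalSpace Opposite
open Literature.AlgebraicGeometry.Modules

universe u

namespace Literature.AlgebraicGeometry.Morphisms

section Abstract

variable {X : Scheme.{u}} [IsLocallyNoetherian X] {K : X.Modules → Prop}
  (hK₀ : ∀ M : X.Modules, Coh M → (∀ ⦃V : X.Opens⦄, IsAffineOpen V → ∀ m : Γ(M, V), m = 0) → K M)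
  (hK₂ : ∀ ⦃S : ShortComplex X.Modules⦄, S.ShortExact → Coh S.X₁ → Coh S.X₃ → K S.X₁ → K S.X₃ → K S.X₂)

include hK₂ in
/-- **The torsion step** for an extension-closed class `K`: if every coherent module killed by `𝓘`,
and every coherent module killed by `𝒥 + 𝓘'`, lies in `K`, and `𝓘𝓘' ≤ 𝒥`, then a coherent `M` with
`𝒥M = 0` lies in `K` (via `0 → M[𝓘] → M → M/M[𝓘] → 0`).
[cite: GortzWedhorn2020, Lemma 12.63 proof (ii) (p. 436)] -/
theorem mem_exactClass_of_torsion_step {M : X.Modules} (hM : Coh M) {J I I' : X.IdealSheafData}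
    (hJ : IsKilledBy J M) (hII' : I * I' ≤ J)
    (h1 : ∀ N : X.Modules, Coh N → IsKilledBy I N → K N)
    (h2 : ∀ N : X.Modules, Coh N → IsKilledBy (J ⊔ I') N → K N) : K M :=
  hK₂ (shortExact_torsion M I) (hM.torsion I) (hM.cokernel_torsionι I)
    (h1 _ (hM.torsion I) (isKilledBy_torsion M I))
    (h2 _ (hM.cokernel_torsionι I)
      (isKilledBy_cokernel_torsionι hM.loc (IdealSheafData.fg_ideal I) hJ hII'))

include hK₀ hK₂ in
/-- **Dévissage for an arbitrary class** (Görtz–Wedhorn I, Lemma 12.63, by Noetherian induction on the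
annihilating ideal sheaf): if `K` contains the coherent modules with vanishing affine sections and is
closed under extensions of coherent modules, and if the integral heart holds — for every proper radical
ideal sheaf `𝒥` with irreducible support, granted the claim for all strictly larger ideal sheaves, every
coherent `M` with `𝒥M = 0` is in `K` — then every coherent module on the quasi-compact locally
Noetherian `X` is in `K`. (The proof is that of `Morphisms/Devissage.devissage`, with `InK` replaced
by `K`.) [cite: GortzWedhorn2020, Lemma 12.63 (p. 436)] -/
theorem devissage_of_exactClass [CompactSpace X]
    (heart : ∀ J : X.IdealSheafData, J ≠ ⊤ → J.radical = J →
      IsPreirreducible ((J.support : Closeds X) : Set X) →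
      (∀ J' > J, ∀ M : X.Modules, Coh M → IsKilledBy J' M → K M) →
      ∀ M : X.Modules, Coh M → IsKilledBy J M → K M)
    (M : X.Modules) (hM : Coh M) : K M := by
  classical
  suffices H : ∀ (J : X.IdealSheafData) (M : X.Modules), Coh M → IsKilledBy J M → K M by
    refine H ⊥ M hM fun V r hr m => ?_
    have : r = 0 := by simpa [Scheme.IdealSheafData.ideal_bot] using hr
    rw [this, zero_smul]
  haveI := IdealSheafData.wellFoundedGT (X := X)
  intro J
  induction J using (wellFounded_gt (α := X.IdealSheafData)).induction with
  | _ J ih =>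
  intro M hM hJ
  -- `𝒥 = ⊤`
  by_cases htop : J = ⊤
  · subst htop
    exact hK₀ M hM (InK.sections_eq_zero_of_isKilledBy_top hJ)
  have htop' : ¬ (⊤ : X.IdealSheafData) ≤ J := fun h => htop (top_le_iff.mp h)
  by_cases hrad : J.radical = J
  swap
  · -- `𝒥` not radical: `𝓘 = √𝒥`, `𝓘ⁿ⁰⁺¹ ≤ 𝒥` with `n₀` minimal
    have hlt : J < J.radical := lt_of_le_of_ne J.le_radical (Ne.symm hrad)
    have hex : ∃ n : ℕ, J.radical ^ (n + 1) ≤ J := by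
      obtain ⟨n, hn⟩ := IdealSheafData.exists_radical_pow_le J
      rcases n with _ | k
      · exact absurd (le_trans (Scheme.IdealSheafData.le_def.mpr fun V => by
          rw [Scheme.IdealSheafData.ideal_pow, Pi.pow_apply, pow_zero, Ideal.one_eq_top]; exact le_top) hn)
          htop'
      · exact ⟨k, hn⟩
    obtain ⟨n₀, hn₀, hmin⟩ : ∃ n₀ : ℕ, J.radical ^ (n₀ + 1) ≤ J ∧ ∀ m < n₀, ¬ J.radical ^ (m + 1) ≤ J :=
      ⟨Nat.find hex, Nat.find_spec hex, fun m hm => Nat.find_min hex hm⟩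
    have hI' : ¬ J.radical ^ n₀ ≤ J := by
      intro h
      rcases n₀ with _ | k
      · exact htop' (le_trans (Scheme.IdealSheafData.le_def.mpr fun V => by
          rw [Scheme.IdealSheafData.ideal_pow, Pi.pow_apply, pow_zero, Ideal.one_eq_top]; exact le_top) h)
      · exact hmin k (lt_add_one k) h
    have hmul : J.radical * J.radical ^ n₀ ≤ J := (pow_succ' J.radical n₀).symm.le.trans hn₀
    have hlt' : J < J ⊔ J.radical ^ n₀ :=
      lt_of_le_of_ne le_sup_left fun h => hI' (le_sup_right.trans h.symm.le)
    exact mem_exactClass_of_torsion_step hK₂ hM hJ hmul (ih _ hlt) (ih _ hlt')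
  by_cases hirr : IsPreirreducible ((J.support : Closeds X) : Set X)
  · exact heart J htop hrad hirr ih M hM hJ
  -- `𝒥` radical with reducible support `T ⊆ z₁ ∪ z₂`
  rw [isPreirreducible_iff_isClosed_union_isClosed] at hirr
  push Not at hirr
  obtain ⟨z₁, z₂, hz₁, hz₂, hsub, h₁, h₂⟩ := hirr
  let Z₁ : Closeds X := J.support ⊓ ⟨z₁, hz₁⟩
  let Z₂ : Closeds X := J.support ⊓ ⟨z₂, hz₂⟩
  have hJle : ∀ Z : Closeds X, Z ≤ J.support → J ≤ Scheme.IdealSheafData.vanishingIdeal Z := fun Z hZ =>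
    Scheme.IdealSheafData.le_support_iff_le_vanishingIdeal.mp hZ
  have hlt : ∀ (z : Set X) (hz : IsClosed z), ¬ ((J.support : Closeds X) : Set X) ⊆ z →
      J < Scheme.IdealSheafData.vanishingIdeal (J.support ⊓ ⟨z, hz⟩) := by
    intro z hz hnot
    refine lt_of_le_of_ne (hJle _ inf_le_left) fun h => hnot ?_
    have hs := congrArg (fun I : X.IdealSheafData => ((I.support : Closeds X) : Set X)) h
    simp only [Scheme.IdealSheafData.coe_support_vanishingIdeal] at hs
    rw [hs]
    exact fun x hx => hx.2
  have hZ : Z₁ ⊔ Z₂ = J.support := by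
    apply le_antisymm (sup_le inf_le_left inf_le_left)
    intro x hx
    rcases hsub hx with h | h
    · exact Or.inl ⟨hx, h⟩
    · exact Or.inr ⟨hx, h⟩
  have hmul : Scheme.IdealSheafData.vanishingIdeal Z₁ * Scheme.IdealSheafData.vanishingIdeal Z₂ ≤ J := by
    have hinf : Scheme.IdealSheafData.vanishingIdeal Z₁ ⊓ Scheme.IdealSheafData.vanishingIdeal Z₂ = J := by
      rw [← Scheme.IdealSheafData.vanishingIdeal_sup, hZ, Scheme.IdealSheafData.vanishingIdeal_support, hrad]
    rw [← hinf]
    exact Scheme.IdealSheafData.le_def.mpr fun V => by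
      rw [Scheme.IdealSheafData.ideal_mul, Scheme.IdealSheafData.ideal_inf]
      exact Ideal.mul_le_inf
  exact mem_exactClass_of_torsion_step hK₂ hM hJ hmul (ih _ (hlt z₁ hz₁ h₁))
    (ih _ (lt_of_lt_of_le (hlt z₂ hz₂ h₂) le_sup_right))

end Abstract

/-! ### The class `𝒦_Ext` satisfies the hypotheses; the finiteness theorem modulo its heart -/

section ExtClass

variable {A : Type u} [CommRing A] (X : Over (Spec (CommRingCat.of A)))

/-- A module all of whose sections over affine opens vanish is a zero object. [folklore] -/
private theorem isZero_of_sections_eq_zero {M : X.left.Modules}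
    (h0 : ∀ ⦃V : X.left.Opens⦄, IsAffineOpen V → ∀ m : Γ(M, V), m = 0) : IsZero M := by
  rw [IsZero.iff_id_eq_zero]
  refine Scheme.Modules.hom_ext _ _ fun V => ?_
  ext m
  rw [Scheme.Modules.Hom.id_app, Scheme.Modules.Hom.zero_app]
  exact (InK.sections_eq_zero_of_affine (X := X.left) h0 V m).trans (by simp)

variable [HasExt.{u + 1} X.left.Modules]

/-- `𝒦_Ext` contains the coherent modules with vanishing affine sections (they are zero).
[cite: GortzWedhorn2020, Lemma 12.63 (p. 436)] -/
theorem extUnitFinite_of_sections_eq_zero (M : X.left.Modules)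
    (h0 : ∀ ⦃V : X.left.Opens⦄, IsAffineOpen V → ∀ m : Γ(M, V), m = 0) : ExtUnitFinite.{u + 1} X M :=
  ExtUnitFinite.of_isZero (isZero_of_sections_eq_zero X h0)

end ExtClass

/-- **The finiteness theorem for proper schemes over a field, modulo its integral heart**: the named
fact `GortzWedhorn2023_cohomology_proper_coherent_finite` (Görtz–Wedhorn II Cor. 23.18 with `R = k`:
`Hⁿ(X, 𝓕) = Extⁿ_{𝒪_X}(𝒪_X, 𝓕)` finite-dimensional for every proper `X → Spec k` and coherent `𝓕`,
on the derived carrier) follows, by the dévissage above for the exact class `𝒦_Ext`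
(`Morphisms/ExtUnitFiniteClass`), from step (iii) of Görtz–Wedhorn I, Lemma 12.63: for every radical
ideal sheaf `𝒥 ≠ ⊤` with irreducible support, granted the claim above `𝒥`, every coherent module
killed by `𝒥` has finite `Extⁿ_{𝒪_X}(𝒪_X, –)` for all `n`.
[cite: GortzWedhorn2023, Cor. 23.18 (p. 425)] [cite: GortzWedhorn2020, Lemma 12.63 (p. 436)] -/
theorem GortzWedhorn2023_cohomology_proper_coherent_finite_of_heart
    (heart : ∀ (k : Type) [Field k] (X : Over (Spec (CommRingCat.of k))) [IsProper X.hom]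
      [IsLocallyNoetherian X.left] (J : X.left.IdealSheafData), J ≠ ⊤ → J.radical = J →
      IsPreirreducible ((J.support : Closeds X.left) : Set X.left) →
      (∀ J' > J, ∀ M : X.left.Modules, Coh M → IsKilledBy J' M → ExtUnitFinite.{1} X M) →
      ∀ M : X.left.Modules, Coh M → IsKilledBy J M → ExtUnitFinite.{1} X M) :
    GortzWedhorn2023_cohomology_proper_coherent_finite := by
  refine GortzWedhorn2023_cohomology_proper_coherent_finite_of_ext fun k _ X _ F hF n => ?_
  haveI : IsLocallyNoetherian X.left := LocallyOfFiniteType.isLocallyNoetherian X.hom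
  haveI : CompactSpace X.left := QuasiCompact.compactSpace_of_compactSpace X.hom
  exact devissage_of_exactClass (K := fun M => ExtUnitFinite.{1} X M)
    (fun M _ h0 => extUnitFinite_of_sections_eq_zero X M h0)
    (fun S hS _ _ h₁ h₃ => ExtUnitFinite.of_shortExact₂ hS h₁ h₃) (heart k X) F hF n

end Literature.AlgebraicGeometry.Morphisms

end
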